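/-
Copyright (c) 2026 the pub-hodgecm-mathlib formalisation cell (harness21).  Prover seat hodgecm-mathlib-LH4-p10 (g8) (KW desk F0P2-p08 (g3) 00:28:58Z (a) «TYPE §4 as the
∃-FRAME HEAD»): Track B «K2-LIT», hLiu418 = stmt-HodgeConjecture-24832, residue #3 (x-a) KIND-W — the frames OF RECORD for (x-a-pres)(ii): ★ arch₄'s closed-form tube frames,
★ FILE 21's conjugator, and the `hex` letter modulo the two analytic letters stated AGAINST those frames.  THEOREMS ONLY.
-/
import Summits.HodgeConjecture.HodgeConjecture.Theorems.K2LiuKindWArchContinuationOfRecord   -- ★ (this seat) `hex_of_conjugator` (+ ★ p863520's ★ FILE 22 imports: arch₄, reading frames, ★ FILE 21)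
import HarnessLib

/-!
# Crux `HLiu418`, residue #3 (x-a) KIND-W — (x-a-pres)(ii): THE FRAMES OF RECORD and the `hex` letter modulo `heb`, `hW`

Cell `hodgecm-mathlib`, crux item hLiu418 = `stmt-HodgeConjecture-24832`; squad K2, KW desk F0P2-p08 (g3) word 00:28:58Z (a): «a frames-inside `hex_of_std` is ill-posed
(`heb`∕`hW` speak about `Fr B C g`, `g` existential in ★ FILE 21): TYPE §4 as the ∃-FRAME HEAD».  Lane `--supports stmt-HodgeConjecture-24832 --as helper` (count-neutral).
THEOREMS ONLY (no `def`, no instance, no notation, no named-fact hypothesis, no `sorry`).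

THE POINT.  ★ `K2LiuKindWArchContinuationOfRecord.hex_of_conjugator` pays ★ p863152's `hex` from the letters of record PLUS two analytic letters — the character's frame
reading `heb` and the per-place twisted Whittaker letters `hW` — both of which are statements ABOUT a tube frame `(T, Tinv, Fr)`, its anti-diagonal reading `(B, C)` and the
arch conjugator `g`.  Here those objects are PRODUCED ONCE, of record, and EXPORTED as ∃-binders with every frame fact the two payers (K2Liu-p11's `heb`, LH4-p08's ∕ K2E4-p11's
`hW`) and ★ FILE 18 need:
* the closed-form Shimura frames of ★ arch₄ `exists_tubeFrame_arch₄` at every complex place (`hTdef`, `hTinvdef` — the SAME bytes as ★ p863520's `hconj` and ★ FILE 21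
  `exists_frameCompact_conjugator`), `Fr a w := T_w · a_w · T_w⁻¹` (`hFr`), `T T⁻¹ = 1 = T⁻¹ T`, unitarity `hTU`, Siegel shape `hTS`, surjectivity `hTV`, the unipotent
  letters `hTiv hTN`, the anti-diagonal reading `hBC` with `det C_w` a unit;
* the conjugator `g` of ★ FILE 21 for the standard datum `𝒦′` (`hg`, read in the frame `Fr`);
* and then: `∀ eb, heb(Fr, eb) → hW(Fr, B, C, g, eb) → ‹★ p863152's hex VERBATIM›` (★ `hex_of_conjugator`, the reading frames `fr hfrc hfrτ` of ★ `exists_readingFrame` +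
  ★ `tube_eq_of_chart_formula` + ★ `kappa_eq` and the Shimura invertibility ★ `isUnit_det_shimuraFrame` supplied inside, exactly as ★ p863520 §3's preamble).
Inputs: `dV dW ≠ 0`, `χ` of unitary archimedean type `(t, 0)`, a STANDARD Iwasawa datum `𝒦′`, `s₀`, the (KW-fac) arch factors `A j` with their three clauses VERBATIM, the bad
set `T₀`, Haar carriers `νinf`, and `FinfT` with its reading `hread`.
HONEST LABEL.  Count-neutral helper; `heb` and `hW` remain the named analytic inputs of the KIND-W `hex` column: `HC_CM` is proved only modulo the 7 printed citations
(2 remaining named inputs: hLiu418 = `stmt-HodgeConjecture-24832`, h413 = `stmt-HodgeConjecture-24833`) until rung 0 closes.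

## References
* [Shimura1997] G. Shimura, *Euler Products and Eisenstein Series*, CBMS 93 (1997), §16.4, §18.4.
* [KudlaRallis1994] S. Kudla, S. Rallis, Ann. of Math. 140 (1994), §1–§2.
* [Tan1999] V. Tan, *Poles of Siegel Eisenstein series on U(n,n)*, Canad. J. Math. 51 (1999), §1, §3.
* [BorelJacquet1979] A. Borel, H. Jacquet, Proc. Symp. Pure Math. 33 (1979), §4.1.
-/

set_option autoImplicit false
set_option linter.dupNamespace false -- the mandated namespace repeats `HodgeConjecture.HodgeConjecture`

noncomputable section

open Complex Matrix MeasureTheory MeasureTheory.Measure NumberField NumberField.InfinitePlace IsDedekindDomain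
open scoped ComplexConjugate NNReal Classical
open Literature.NumberTheory.GaloisRepresentations
open Literature.NumberTheory.Automorphic Literature.NumberTheory.Automorphic.UnitaryGroup
open Literature.NumberTheory.GelbartRogawski1991 Literature.NumberTheory.GelbartRogawski1991.GRConstruction
open Literature.NumberTheory.GelbartRogawski1991.UnitaryDualPair
open Literature.NumberTheory.K2Lit.SiegelDoubled
open Literature.NumberTheory.ModularForms.SiegelUpperHalfSpace (moeb denom)

namespace Summit.HodgeConjecture.HodgeConjecture.Cruxes.HLiu418.K2LiuKindWArchContinuationFramesOfRecord

open K2LiuU22CompactPictureDefs K2LiuArchInducedTubeDefs K2LiuSiegelUnipotentLocalDefs K2LiuArchSWSpanningDefs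
open K2LiuSiegelUnipotentFourierDefs (skewMatrices unipDeltaChar)
open K2LiuSiegelEisensteinKindWLetters (kindWFinset)
open K2LiuHermitianTubeFrameSign (exists_tubeFrame_arch₄)
open K2LiuHermitianTubeFrameArch (tw_ne_zero)
open K2LiuArchSiegelCharacterTube (isUnit_det_shimuraFrame)
open K2LiuArchReadingFrame (exists_readingFrame)
open K2LiuArchSiegelCharacterTubeConsumer (tube_eq_of_chart_formula)
open K2LiuArchFrameBridge (kappa_eq)
open K2LiuArchFrameCompactConjugator (exists_frameCompact_conjugator)
open K2LiuKindWArchLetterDefs (archWhittakerIntegral)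
open K2LiuKindWArchContinuationOfRecord (hex_of_conjugator)

variable (L : Type) [Field L] [NumberField L] [IsCMField L]
variable {N₀ M₀ : ℕ} (e : Fin N₀ × Fin M₀ ≃ Fin 2)
  (dV : Fin N₀ → L) (hdV : ∀ i, IsCMField.complexConj L (dV i) = dV i)
  (dW : Fin M₀ → L) (hdW : ∀ i, IsCMField.complexConj L (dW i) = dW i)
  [MeasurableSpace ↥(unipDeltaArch L e dV hdV dW hdW)] [BorelSpace ↥(unipDeltaArch L e dV hdV dW hdW)]

/-- **THE FRAMES OF RECORD AND THE `hex` LETTER MODULO `heb`, `hW`.**  For `dV dW ≠ 0`, `χ` of unitary archimedean type `(t,0)`, a standard Iwasawa datum `𝒦′`, `s₀`, the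
(KW-fac) arch factors `A j` (`hAlaw hfin hAc` VERBATIM), the bad set `T₀`, Haar carriers `νinf` and `FinfT` with its reading `hread`: THERE EXIST tube frames `T, T⁻¹` (★ arch₄'s
closed forms), the frame map `Fr`, the anti-diagonal blocks `B, C` and a conjugator `g` (★ FILE 21) carrying the listed frame facts, such that for EVERY frame reading `eb`,
`heb(Fr, eb) → hW(Fr, B, C, g, eb) →` ★ p863152 `kindWArchLetter_eq_integral`'s `hex` VERBATIM.  (★ `hex_of_conjugator` behind ★ p863520 §3's preamble.)
[cite: Shimura1997, §16.4, §18.4] [cite: KudlaRallis1994, §1–§2] [cite: Tan1999, §1, §3] [cite: BorelJacquet1979, §4.1] -/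
theorem exists_frames_hex_of_std (hdV0 : ∀ i, dV i ≠ 0) (hdW0 : ∀ i, dW i ≠ 0)
    {χ : HeckeCharacter L} {t : InfinitePlace L → ℤ} (ht : χ.HasUnitaryArchType t 0)
    (𝒦' : IwasawaDatum L e dV hdV dW hdW) (h𝒦' : 𝒦'.IsStd) (s₀ : ℂ) {m : ℕ}
    (A : Fin m → UnitaryGroup.arch (Fp L) L (IsCMField.complexConj L) (2 + 2) (hermD L e dV hdV dW hdW) → ℂ)
    (hAlaw : ∀ j, ∀ p : HA L e dV hdV dW hdW, IsSiegelDelta L e dV hdV dW hdW p → UnitaryGroup.finPart (Fp L) L (IsCMField.complexConj L) (2 + 2) (hermD L e dV hdV dW hdW) p = 1 →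
      ∀ x : UnitaryGroup.arch (Fp L) L (IsCMField.complexConj L) (2 + 2) (hermD L e dV hdV dW hdW),
        A j (UnitaryGroup.archPart (Fp L) L (IsCMField.complexConj L) (2 + 2) (hermD L e dV hdV dW hdW) p * x) = siegelDeltaCharacter L e dV hdV dW hdW χ s₀ p * A j x)
    (hfin : ∀ j, ∃ V : Submodule ℂ (UnitaryGroup.arch (Fp L) L (IsCMField.complexConj L) (2 + 2) (hermD L e dV hdV dW hdW) → ℂ), FiniteDimensional ℂ V ∧ A j ∈ V ∧
      ∀ a₀ : UnitaryGroup.arch (Fp L) L (IsCMField.complexConj L) (2 + 2) (hermD L e dV hdV dW hdW),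
        (UnitaryGroup.archToAdelic (Fp L) L (IsCMField.complexConj L) (2 + 2) (hermD L e dV hdV dW hdW) a₀ : HA L e dV hdV dW hdW) ∈ 𝒦'.K → ∀ G ∈ V, (fun x => G (x * a₀)) ∈ V)
    (hAc : ∀ j, Continuous (A j))
    (FinfT : Fin m → skewMatrices ((IsCMField.complexConj L : L ≃ₐ[Fp L] L) : L →+* L) ((gramR L e dV hdV dW hdW).map (algebraMap (Fp L) L)) →
      HA L e dV hdV dW hdW → ℂ → UnitaryGroup.arch (Fp L) L (IsCMField.complexConj L) (2 + 2) (hermD L e dV hdV dW hdW) → ℂ)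
    (hread : ∀ (S : skewMatrices ((IsCMField.complexConj L : L ≃ₐ[Fp L] L) : L →+* L) ((gramR L e dV hdV dW hdW).map (algebraMap (Fp L) L)))
      (h : HA L e dV hdV dW hdW) (s : ℂ) (j : Fin m) (a : UnitaryGroup.arch (Fp L) L (IsCMField.complexConj L) (2 + 2) (hermD L e dV hdV dW hdW)),
      FinfT j S h s a =
        (((modDelta L e dV hdV dW hdW (𝒦'.pPart (UnitaryGroup.archToAdelic (Fp L) L (IsCMField.complexConj L) (2 + 2) (hermD L e dV hdV dW hdW) a)) : ℝ) : ℂ) ^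
            (2 * (s - s₀))) * A j a)
    (T₀ : Finset (HeightOneSpectrum (𝓞 (Fp L))))
    (νinf : Finset (HeightOneSpectrum (𝓞 (Fp L))) → Measure ↥(unipDeltaArch L e dV hdV dW hdW)) [∀ T' : Finset (HeightOneSpectrum (𝓞 (Fp L))), (νinf T').IsHaarMeasure] :
    ∃ (T Tinv : {w : InfinitePlace L // w.IsComplex} → Matrix (Fin 2 ⊕ Fin 2) (Fin 2 ⊕ Fin 2) ℂ)
      (Fr : UnitaryGroup.arch (Fp L) L (IsCMField.complexConj L) (2 + 2) (hermD L e dV hdV dW hdW) →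
        {w : InfinitePlace L // w.IsComplex} → Matrix (Fin 2 ⊕ Fin 2) (Fin 2 ⊕ Fin 2) ℂ)
      (B C : {w : InfinitePlace L // w.IsComplex} → Matrix (Fin 2) (Fin 2) ℂ)
      (g : UnitaryGroup.arch (Fp L) L (IsCMField.complexConj L) (2 + 2) (hermD L e dV hdV dW hdW)),
      (∀ w, T w = fromBlocks (diagonal (fun k => (Real.sqrt (|(w.1.embedding (dV (e.symm k).1 * dW (e.symm k).2)).re| / 2) : ℂ))) (diagonal (fun k => (Real.sqrt (|(w.1.embedding (dV (e.symm k).1 * dW (e.symm k).2)).re| / 2) : ℂ)))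
          (diagonal (fun k => I * ((((w.1.embedding (dV (e.symm k).1 * dW (e.symm k).2)).re / |(w.1.embedding (dV (e.symm k).1 * dW (e.symm k).2)).re|) * Real.sqrt (|(w.1.embedding (dV (e.symm k).1 * dW (e.symm k).2)).re| / 2) : ℝ) : ℂ))) (-diagonal (fun k => I * ((((w.1.embedding (dV (e.symm k).1 * dW (e.symm k).2)).re / |(w.1.embedding (dV (e.symm k).1 * dW (e.symm k).2)).re|) * Real.sqrt (|(w.1.embedding (dV (e.symm k).1 * dW (e.symm k).2)).re| / 2) : ℝ) : ℂ)))) ∧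
      (∀ w, Tinv w = fromBlocks (diagonal (fun k => (((Real.sqrt (|(w.1.embedding (dV (e.symm k).1 * dW (e.symm k).2)).re| / 2))⁻¹ / 2 : ℝ) : ℂ))) (-diagonal (fun k => I * (((Real.sqrt (|(w.1.embedding (dV (e.symm k).1 * dW (e.symm k).2)).re| / 2))⁻¹ * ((w.1.embedding (dV (e.symm k).1 * dW (e.symm k).2)).re / |(w.1.embedding (dV (e.symm k).1 * dW (e.symm k).2)).re|) / 2 : ℝ) : ℂ)))
          (diagonal (fun k => (((Real.sqrt (|(w.1.embedding (dV (e.symm k).1 * dW (e.symm k).2)).re| / 2))⁻¹ / 2 : ℝ) : ℂ))) (diagonal (fun k => I * (((Real.sqrt (|(w.1.embedding (dV (e.symm k).1 * dW (e.symm k).2)).re| / 2))⁻¹ * ((w.1.embedding (dV (e.symm k).1 * dW (e.symm k).2)).re / |(w.1.embedding (dV (e.symm k).1 * dW (e.symm k).2)).re|) / 2 : ℝ) : ℂ)))) ∧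
      (∀ a w, Fr a w = T w * Matrix.reindex (e₂ (n := 2)).symm (e₂ (n := 2)).symm
        (((UnitaryGroup.archAt (Fp L) L (IsCMField.complexConj L) (2 + 2) (hermD L e dV hdV dW hdW) w
          (UnitaryGroup.complexConj_smul_infinitePlace L w.1) (IsCMField.complexConj_ne_one L) a :
            UnitaryGroup.archLocal L (2 + 2) (hermD L e dV hdV dW hdW) w) : GL (Fin (2 + 2)) ℂ) : Matrix (Fin (2 + 2)) (Fin (2 + 2)) ℂ) * Tinv w) ∧
      (∀ w, T w * Tinv w = 1) ∧ (∀ w, Tinv w * T w = 1) ∧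
      (∀ w (g : GL (Fin (2 + 2)) ℂ), g ∈ UnitaryGroup.archLocal L (2 + 2) (hermD L e dV hdV dW hdW) w →
        (T w * Matrix.reindex (e₂ (n := 2)).symm (e₂ (n := 2)).symm (g : Matrix _ _ ℂ) * Tinv w)ᴴ * Matrix.J (Fin 2) ℂ *
          (T w * Matrix.reindex (e₂ (n := 2)).symm (e₂ (n := 2)).symm (g : Matrix _ _ ℂ) * Tinv w) = Matrix.J (Fin 2) ℂ) ∧
      (∀ w (g : GL (Fin (2 + 2)) ℂ), IsSiegelM (n := 2) (g : Matrix (Fin (2 + 2)) (Fin (2 + 2)) ℂ) →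
        (T w * Matrix.reindex (e₂ (n := 2)).symm (e₂ (n := 2)).symm (g : Matrix _ _ ℂ) * Tinv w).toBlocks₂₁ = 0) ∧
      (∀ w (u : GL (Fin (2 + 2)) ℂ), u ∈ UnitaryGroup.archLocal L (2 + 2) (hermD L e dV hdV dW hdW) w →
        K2LiuSiegelUnipotentLocalDefs.IsUnipM (n := 2) (u : Matrix (Fin (2 + 2)) (Fin (2 + 2)) ℂ) →
          ∃ b : Matrix (Fin 2) (Fin 2) ℂ, bᴴ = b ∧ T w * Matrix.reindex (e₂ (n := 2)).symm (e₂ (n := 2)).symm (u : Matrix _ _ ℂ) * Tinv w = fromBlocks 1 b 0 1) ∧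
      (∀ w (b : Matrix (Fin 2) (Fin 2) ℂ), bᴴ = b → ∃ u : GL (Fin (2 + 2)) ℂ,
        u ∈ UnitaryGroup.archLocal L (2 + 2) (hermD L e dV hdV dW hdW) w ∧ K2LiuSiegelUnipotentLocalDefs.IsUnipM (n := 2) (u : Matrix (Fin (2 + 2)) (Fin (2 + 2)) ℂ) ∧
          T w * Matrix.reindex (e₂ (n := 2)).symm (e₂ (n := 2)).symm (u : Matrix _ _ ℂ) * Tinv w = fromBlocks 1 b 0 1) ∧
      (∀ w (P : Matrix (Fin 2 ⊕ Fin 2) (Fin 2 ⊕ Fin 2) ℂ), Pᴴ * Matrix.J (Fin 2) ℂ * P = Matrix.J (Fin 2) ℂ →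
        ∃ g : GL (Fin (2 + 2)) ℂ, g ∈ UnitaryGroup.archLocal L (2 + 2) (hermD L e dV hdV dW hdW) w ∧
          T w * Matrix.reindex (e₂ (n := 2)).symm (e₂ (n := 2)).symm (g : Matrix _ _ ℂ) * Tinv w = P) ∧
      (∀ w, T w * fromBlocks 1 0 0 (-1) * Tinv w = fromBlocks 0 (B w) (C w) 0) ∧ (∀ w, IsUnit (C w).det) ∧
      (∀ k : UnitaryGroup.arch (Fp L) L (IsCMField.complexConj L) (2 + 2) (hermD L e dV hdV dW hdW),
        (∀ w, moeb (Fr k w) (I • (1 : Matrix (Fin 2) (Fin 2) ℂ)) = I • 1) →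
          (UnitaryGroup.archToAdelic (Fp L) L (IsCMField.complexConj L) (2 + 2) (hermD L e dV hdV dW hdW) (g * k * g⁻¹) : HA L e dV hdV dW hdW) ∈ 𝒦'.K) ∧
      ∀ eb : skewMatrices ((IsCMField.complexConj L : L ≃ₐ[Fp L] L) : L →+* L) ((gramR L e dV hdV dW hdW).map (algebraMap (Fp L) L)) → HA L e dV hdV dW hdW →
      {w : InfinitePlace L // w.IsComplex} → Matrix (Fin 2) (Fin 2) ℂ → ℂ,
        (∀ (S : skewMatrices ((IsCMField.complexConj L : L ≃ₐ[Fp L] L) : L →+* L) ((gramR L e dV hdV dW hdW).map (algebraMap (Fp L) L)))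
      (h : HA L e dV hdV dW hdW) (u : ↥(unipDeltaArch L e dV hdV dW hdW)),
      (conj (unipDeltaChar L e dV hdV dW hdW (S : Matrix (Fin 2) (Fin 2) L)
          (UnitaryGroup.archToAdelic (Fp L) L (IsCMField.complexConj L) (2 + 2) (hermD L e dV hdV dW hdW)
            (u : UnitaryGroup.arch (Fp L) L (IsCMField.complexConj L) (2 + 2) (hermD L e dV hdV dW hdW))) : ℂ)) =
        ∏ w, eb S h w (Matrix.toBlocks₁₂ (Fr (u : UnitaryGroup.arch (Fp L) L (IsCMField.complexConj L) (2 + 2) (hermD L e dV hdV dW hdW)) w))) →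
        (∀ (S : skewMatrices ((IsCMField.complexConj L : L ≃ₐ[Fp L] L) : L →+* L) ((gramR L e dV hdV dW hdW).map (algebraMap (Fp L) L)))
      (h : HA L e dV hdV dW hdW) (w : {w : InfinitePlace L // w.IsComplex}) (Q : Carrier),
      ∃ Ew : ℂ → ℂ, DifferentiableOn ℂ Ew {s : ℂ | 0 < s.re} ∧ ∀ s : ℂ, ((2 : ℕ) : ℝ) / 2 < s.re →
        ∀ F : Matrix (Fin 2 ⊕ Fin 2) (Fin 2 ⊕ Fin 2) ℂ → ℂ, IsArchSiegelSection (fun z : ℂ => (conj z / ((‖z‖ : ℝ) : ℂ)) ^ (-(t w.1))) s F →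
          (∀ (v : Matrix (Fin 2) (Fin 2) ℂ), vᴴ * v = 1 → ∀ hv : v.det ≠ 0,
            F ((2 : ℂ)⁻¹ • fromBlocks (1 + v) (-(I • (1 - v))) (I • (1 - v)) (1 + v) : Matrix (Fin 2 ⊕ Fin 2) (Fin 2 ⊕ Fin 2) ℂ) = evalAt v hv Q) →
          ∫ x : Fin 2 → Fin 2 → ℝ, F ((fromBlocks 0 (B w) (C w) 0 : Matrix (Fin 2 ⊕ Fin 2) (Fin 2 ⊕ Fin 2) ℂ) * fromBlocks 1 (hermOfReal x) 0 1 *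
              Fr (UnitaryGroup.archPart (Fp L) L (IsCMField.complexConj L) (2 + 2) (hermD L e dV hdV dW hdW) h * g) w) *
            eb S h w (hermOfReal x) = Ew s) →
      ∀ (j : Fin m) (S : skewMatrices ((IsCMField.complexConj L : L ≃ₐ[Fp L] L) : L →+* L) ((gramR L e dV hdV dW hdW).map (algebraMap (Fp L) L)))
        (h : HA L e dV hdV dW hdW), (S : Matrix (Fin 2) (Fin 2) L).det ≠ 0 →
        ∃ F : ℂ → ℂ, DifferentiableOn ℂ F {s : ℂ | 0 < s.re} ∧ ∀ s : ℂ, ((2 : ℕ) : ℝ) / 2 < s.re → F s =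
          archWhittakerIntegral L e dV hdV dW hdW (νinf (kindWFinset L e dV hdV dW hdW T₀ (S : Matrix (Fin 2) (Fin 2) L) h)) (S : Matrix (Fin 2) (Fin 2) L)
            (FinfT j S h) (UnitaryGroup.archPart (Fp L) L (IsCMField.complexConj L) (2 + 2) (hermD L e dV hdV dW hdW) h) s := by
  -- ★ p863520 §3's preamble, verbatim: the tube frames of record (★ arch₄) `choose`n once, their anti-diagonal reading, the Shimura invertibility
  choose T Tinv h1 h2 hTU hTS hTiv hTN hTV hW hTdef hTinvdef using fun w : {w : InfinitePlace L // w.IsComplex} =>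
    exists_tubeFrame_arch₄ L e dV hdV dW hdW w (UnitaryGroup.complexConj_smul_infinitePlace L w.1) hdV0 hdW0
  choose B C hCu hBC using hW
  have hDC := fun w : {w : InfinitePlace L // w.IsComplex} => isUnit_det_shimuraFrame (n := 2)
    (fun k => (w.1.embedding (dV (e.symm k).1 * dW (e.symm k).2)).re)
    (tw_ne_zero L e dV hdV dW hdW w (UnitaryGroup.complexConj_smul_infinitePlace L w.1) hdV0 hdW0)
  obtain ⟨Fr, hFr⟩ : ∃ Fr : UnitaryGroup.arch (Fp L) L (IsCMField.complexConj L) (2 + 2) (hermD L e dV hdV dW hdW) → {w : InfinitePlace L // w.IsComplex} → Matrix (Fin 2 ⊕ Fin 2) (Fin 2 ⊕ Fin 2) ℂ,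
      ∀ k w, Fr k w = T w * Matrix.reindex (e₂ (n := 2)).symm (e₂ (n := 2)).symm (((UnitaryGroup.archAt (Fp L) L (IsCMField.complexConj L) (2 + 2) (hermD L e dV hdV dW hdW) w (UnitaryGroup.complexConj_smul_infinitePlace L w.1) (IsCMField.complexConj_ne_one L) k : UnitaryGroup.archLocal L (2 + 2) (hermD L e dV hdV dW hdW) w) : GL (Fin (2 + 2)) ℂ) : Matrix (Fin (2 + 2)) (Fin (2 + 2)) ℂ) * Tinv w :=
    ⟨_, fun _ _ => rfl⟩
  -- reading frames
  obtain ⟨fr, hfrM, hfrc, -⟩ := exists_readingFrame L e dV hdV dW hdW hdV0 hdW0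
  have hfrτ : ∀ w (u : Matrix.unitaryGroup (Fin 2) ℂ),
      T w * Matrix.reindex (e₂ (n := 2)).symm (e₂ (n := 2)).symm (((fr w u : UnitaryGroup.archLocal L (2 + 2) (hermD L e dV hdV dW hdW) w) : GL (Fin (2 + 2)) ℂ) :
        Matrix (Fin (2 + 2)) (Fin (2 + 2)) ℂ) * Tinv w =
      (2 : ℂ)⁻¹ • fromBlocks (1 + (u : Matrix (Fin 2) (Fin 2) ℂ)) (-(I • (1 - (u : Matrix (Fin 2) (Fin 2) ℂ)))) (I • (1 - (u : Matrix (Fin 2) (Fin 2) ℂ))) (1 + (u : Matrix (Fin 2) (Fin 2) ℂ)) := by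
    intro w u
    have hG := hfrM w u
    rw [← hTdef w, ← hTinvdef w] at hG
    rw [tube_eq_of_chart_formula (T w) (Tinv w) (h1 w) hG, kappa_eq]
  -- the conjugator of ★ FILE 21 for the standard datum, read in the frame
  obtain ⟨g, hg⟩ := exists_frameCompact_conjugator L e dV hdV hdV0 dW hdW hdW0 h𝒦' T Tinv hTdef hTinvdef
  have hg' : ∀ k : UnitaryGroup.arch (Fp L) L (IsCMField.complexConj L) (2 + 2) (hermD L e dV hdV dW hdW), (∀ w, moeb (Fr k w) (I • (1 : Matrix (Fin 2) (Fin 2) ℂ)) = I • 1) →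
      (UnitaryGroup.archToAdelic (Fp L) L (IsCMField.complexConj L) (2 + 2) (hermD L e dV hdV dW hdW) (g * k * g⁻¹) : HA L e dV hdV dW hdW) ∈ 𝒦'.K :=
    fun k hk => hg k fun w => by rw [← hFr]; exact hk w
  refine ⟨T, Tinv, Fr, B, C, g, hTdef, hTinvdef, hFr, h1, h2, hTU, hTS, hTiv, hTN, hTV, hBC, hCu, hg', fun eb heb hWl => ?_⟩
  exact hex_of_conjugator L e dV hdV dW hdW Fr T Tinv hFr h2 hTU hdV0 hdW0 h1 hTiv hTN hTS hTV
    (fun w => diagonal fun k => (Real.sqrt (|(w.1.embedding (dV (e.symm k).1 * dW (e.symm k).2)).re| / 2) : ℂ))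
    (fun w => diagonal fun k => I * ((((w.1.embedding (dV (e.symm k).1 * dW (e.symm k).2)).re / |(w.1.embedding (dV (e.symm k).1 * dW (e.symm k).2)).re|) *
      Real.sqrt (|(w.1.embedding (dV (e.symm k).1 * dW (e.symm k).2)).re| / 2) : ℝ) : ℂ))
    hTdef (fun w => (hDC w).1) (fun w => (hDC w).2) fr hfrc hfrτ B C hBC T₀ νinf 𝒦' g hg' ht s₀ A hAlaw hfin hAc FinfT hread eb heb hWl

end Summit.HodgeConjecture.HodgeConjecture.Cruxes.HLiu418.K2LiuKindWArchContinuationFramesOfRecord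

end
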